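import Summits.HodgeConjecture.HodgeConjecture.Theorems.K2LiuNonsplitSliceCompact       -- ★ (NS-c) (K2Liu-p04)
import Literature.NumberTheory.Automorphic.AnisotropicUnitaryGroupCompactLocal             -- ★ `compactSpace_local_of_anisotropic`
import Literature.NumberTheory.Automorphic.UnitaryGroupLocalFactors                        -- ★ `localPiEquiv : localPi ≃ₜ* «local»`

/-!
# The finite slice of #32dR at a NON-SPLIT place where the hermitian plane is ANISOTROPIC (organ (AN) + (NS-c) of (Bv-nonsplit))

Track B ∕ K2-LIT, hLiu418 = stmt-HodgeConjecture-24832; socket #32dR `sig_K2LiuDoublingHeightDecayLocalR2` (U5d ED. 5 :554) through ★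
`K2LiuDoublingHeightDecayLocalR2OfNonsplitData.doublingHeightDecayLocalR2_of_nonsplitData` (p857289): at a non-split `v ∈ S` the closer wants
`IsCompact univ ∨ ‹rank-one datum›`.  LEAD F0P6-plan (g11) M-155c (iv) ∕ M-155g (iii): organ (AN) «`V_v` anisotropic ⇒ `G_v` compact» → K2Liu-p04 (g3).
CENSUS RESULT: (AN) is ★ in the tree's one-place currency — `Literature.NumberTheory.Automorphic.UnitaryGroup.compactSpace_local_of_anisotropic`
(`AnisotropicUnitaryGroupCompactLocal`, over ★ `HermitianLattice.compactSpace_unitaryGroupOfForm_of_anisotropic`: an anisotropic hermitian form over a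
discretely valued field with compact valuation ring has compact unitary group; [PlatonovRapinchuk1994, §3.1 Thm. 3.1]).  THIS FILE transports it to the
`Π_{w∣v}` model `UnitaryGroup.localPi` of the #32d frame along ★ `localPiEquiv : localPi ≃ₜ* «local»` and feeds ★ (NS-c):
* `compactSpace_localPi_of_anisotropic` ∕ `isCompact_univ_localPi_of_anisotropic` — `U(H)(L⁺_v)` (the `localPi` carrier) is compact when, at the place
  `w ∣ v` fixed by `c`, the pairing `h_{H,w}(x,x) = 0 ⇒ x = 0` on `L_w^N` (any `N`, any `H`);
* **`integrable_placeSlice_anisotropic`** — hence, in the #32d frame, the slice `u ↦ Φ(ι(ιA placesEmbed_S(1, u at v), 1))^τ` is integrable for EVERY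
  real `τ` at such a `v ∈ S` (= the `Or.inl` branch of the closer's `_hns`).
Theorems only; no `sorry`; default heartbeats.  [PlatonovRapinchuk1994, §3.1 Thm. 3.1, §6.2]; [GelbartPiatetskishapiroRallis1987, Part A §6]; [Li1992, §3].
HONEST LABEL: HC_CM is proved only modulo the 7 printed citations (2 remaining named inputs: hLiu418 = stmt-HodgeConjecture-24832, h413 =
stmt-HodgeConjecture-24833) until rung 0 closes; count-neutral helper toward #32dR, retires nothing by itself.
-/

set_option autoImplicit false
-- the mandated namespace repeats the single-problem summit's segment (`HodgeConjecture.HodgeConjecture`)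
set_option linter.dupNamespace false

noncomputable section

open scoped Matrix
open NumberField IsDedekindDomain MeasureTheory

namespace Summit.HodgeConjecture.HodgeConjecture.Cruxes.HLiu418.K2LiuNonsplitSliceAnisotropic

open Literature.NumberTheory.Automorphic Literature.NumberTheory.Automorphic.UnitaryGroup
open Literature.NumberTheory.GelbartRogawski1991 Literature.NumberTheory.GelbartRogawski1991.GRConstruction
open Literature.NumberTheory.K2Lit.SiegelDoubled Literature.NumberTheory.K2Lit.PlaceSplitting
open Summit.HodgeConjecture.HodgeConjecture.Cruxes.HLiu418.K2LiuNonsplitSliceCompact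

/-! ## §1 (AN) in the `localPi` model -/

/-- **`U(H)(L⁺_v)` is COMPACT at a non-split place where `H` is anisotropic** (`localPi` model; ★ `compactSpace_local_of_anisotropic` transported along
★ `localPiEquiv`). [cite: PlatonovRapinchuk1994, §3.1 Thm. 3.1] -/
theorem compactSpace_localPi_of_anisotropic (L : Type) [Field L] [NumberField L] [IsCMField L] {N : ℕ} (H : Matrix (Fin N) (Fin N) L)
    (v : HeightOneSpectrum (𝓞 (Fp L))) (w : UnitaryGroup.PlacesOver L v) (hw : IsCMField.complexConj L • w.1 = w.1)
    (hanis : ∀ x : Fin N → w.1.adicCompletion L,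
      UnitaryGroup.hermForm (galAdicCompletionMap (L := L) (IsCMField.complexConj L) hw) (UnitaryGroup.placeForm H w.1) x x = 0 → x = 0) :
    CompactSpace (UnitaryGroup.localPi L (IsCMField.complexConj L) N H v) := by
  haveI : Algebra.IsQuadraticExtension (Fp L) L := IsCMField.isQuadraticExtension L
  haveI := compactSpace_local_of_anisotropic (IsCMField.complexConj L) H v w hw (IsCMField.complexConj_ne_one L) hanis
  exact (UnitaryGroup.localPiEquiv L (IsCMField.complexConj L) N H v).toHomeomorph.symm.compactSpace

/-- the same as `IsCompact univ` (the `Or.inl` token of ★ `doublingHeightDecayLocalR2_of_nonsplitData`'s `_hns`). [cite: PlatonovRapinchuk1994, §3.1 Thm. 3.1] -/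
theorem isCompact_univ_localPi_of_anisotropic (L : Type) [Field L] [NumberField L] [IsCMField L] {N : ℕ} (H : Matrix (Fin N) (Fin N) L)
    (v : HeightOneSpectrum (𝓞 (Fp L))) (w : UnitaryGroup.PlacesOver L v) (hw : IsCMField.complexConj L • w.1 = w.1)
    (hanis : ∀ x : Fin N → w.1.adicCompletion L,
      UnitaryGroup.hermForm (galAdicCompletionMap (L := L) (IsCMField.complexConj L) hw) (UnitaryGroup.placeForm H w.1) x x = 0 → x = 0) :
    IsCompact (Set.univ : Set (UnitaryGroup.localPi L (IsCMField.complexConj L) N H v)) := by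
  haveI := compactSpace_localPi_of_anisotropic L H v w hw hanis
  exact isCompact_univ

/-! ## §2 The slice at an anisotropic non-split place -/

variable (L : Type) [Field L] [NumberField L] [IsCMField L]
variable {N M n : ℕ} (e : Fin N × Fin M ≃ Fin n)
  (dV : Fin N → L) (hdV : ∀ i, IsCMField.complexConj L (dV i) = dV i)
  (dW : Fin M → L) (hdW : ∀ i, IsCMField.complexConj L (dW i) = dW i)
  (H : Matrix (Fin N) (Fin N) L) (t : L) (ht : t ≠ 0) (g : GL (Fin N) L)
  (hg : formCongr ((IsCMField.complexConj L : L ≃ₐ[↥(maximalRealSubfield L)] L) : L →+* L) g (t • H) = Matrix.diagonal dV)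
  (ιA : (UnitaryGroup.adelicGroupData (Fp L) L (IsCMField.complexConj L) N H).Adelic →*
    UnitaryGroup.adelic (Fp L) L (IsCMField.complexConj L) N (Matrix.diagonal dV))
  (hιA : ∀ k, ((ιA k : ↥(UnitaryGroup.adelic (Fp L) L (IsCMField.complexConj L) N (Matrix.diagonal dV))) :
        GL (Fin N) (AdeleRing (𝓞 L) L)) =
      (toAdeleGL L g)⁻¹ * UnitaryGroup.adelicVal (Fp L) L (IsCMField.complexConj L) N H k * toAdeleGL L g)
  (S : Finset (HeightOneSpectrum (𝓞 (Fp L)))) [DecidableEq (HeightOneSpectrum (𝓞 (Fp L)))]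

include ht hg hιA in
/-- **THE FINITE SLICE OF #32d ∕ #32dR AT AN ANISOTROPIC NON-SPLIT PLACE `v ∈ S`**: for every real `τ`, every Haar `ν` and every continuous `Φ > 0` on
`H(𝔸)`, `u ↦ Φ(ι(ιA placesEmbed_S(1, u at v), 1))^τ` is integrable on the (compact) `U(H)(L⁺_v)`.
[cite: PlatonovRapinchuk1994, §3.1 Thm. 3.1] [cite: GelbartPiatetskishapiroRallis1987, Part A §6] -/
theorem integrable_placeSlice_anisotropic (v : S)
    [MeasurableSpace (UnitaryGroup.localPi L (IsCMField.complexConj L) N H v.1)]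
    [BorelSpace (UnitaryGroup.localPi L (IsCMField.complexConj L) N H v.1)]
    (ν : Measure (UnitaryGroup.localPi L (IsCMField.complexConj L) N H v.1)) [ν.IsHaarMeasure]
    {Φ : HA L e dV hdV dW hdW → ℝ} (hΦc : Continuous Φ) (hΦpos : ∀ x, 0 < Φ x) (τ : ℝ)
    (w : UnitaryGroup.PlacesOver L v.1) (hw : IsCMField.complexConj L • w.1 = w.1)
    (hanis : ∀ x : Fin N → w.1.adicCompletion L,
      UnitaryGroup.hermForm (galAdicCompletionMap (L := L) (IsCMField.complexConj L) hw) (UnitaryGroup.placeForm H w.1) x x = 0 → x = 0) :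
    Integrable (fun u => Φ (iotaLeft L e dV hdV dW hdW (ιA (placesEmbed L H S (1, Pi.mulSingle v u)))) ^ τ) ν :=
  integrable_placeSlice_of_isCompact_univ L e dV hdV dW hdW H t ht g hg ιA hιA S v (isCompact_univ_localPi_of_anisotropic L H v.1 w hw hanis)
    ν hΦc hΦpos τ

end Summit.HodgeConjecture.HodgeConjecture.Cruxes.HLiu418.K2LiuNonsplitSliceAnisotropic

end
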